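import Summits.KontsevichZagierPeriods.KontsevichZagierPeriods.Theses.ScissorsAvatars
import Literature.NumberTheory.Transcendental.KZNoriSymbol
import Literature.AlgebraicGeometry.Motives.ClassicalPeriodDatumKernel

/-!
# Crux `OffSectorReduction` (stmt-KontsevichZagierPeriods-4265) — birth skeleton (`Lines/birth.lean`, BC3)

Route `ScissorsAvatars`, auto-crux `OffSectorReduction` (rank 9; the honest complement of the route's
sector crux `MzvScissorsSector` in the deciding theorem `closes hS hO`): every formal `ℤ`-combination
`c` of integral representations with `KZ.eval c = 0` is KZ-equivalent to a vanishing HOMOGENEOUS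
combination of Kontsevich simplex representations `mzvRep s` of ONE weight `w`:
`∃ w c', c' ∈ closure {of (mzvRep s) | weight s = w} ∧ eval c' = 0 ∧ c − c' ∈ KZ.relations`.
The crux docstring names its content: "Conjecture 1 off the MZV sector together with weight
separation". The skeleton cuts it along the two seams the tree already owns for Conjecture 1
(`ker eval = Ψ⁻¹(ker ev) ⊆ ker Ψ`, Kontsevich–Zagier 2001 §4.1 / Huber–Müller-Stach 2017 §13.1, tree
pattern `KZ.kernel_subset_relations_of_isFaithful`) plus the weight seam, so that each stub is a
statement of ONE kind of mathematics:

* `stub_classicalSymbolInjective` (TRANSCENDENCE, conjecture-grade = Grothendieck–Kontsevich; the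
  CONSTRUCTION is part of the claim, nothing is smuggled into an interface): the classical de
  Rham–Betti period datum over `ℚ` exists as an instance of the tree's hypothesis structures
  (`ClassicalPeriodDatum ℚ` with `KernelData`; Huber–Müller-Stach 2017, Ch. 3, §11) and carries Nori
  symbol data `Ψ` for KZ representations (`KZ.NoriSymbolData`: HMS draft III Lemma 11.2.3 /
  Thm. 11.2.4 plus "moves are motivic", Rem. 12.1.7) on which the evaluation of effective formal
  periods is injective (`FormalPeriodEvalInjective`, Kontsevich's formal period conjecture, HMS 2017
  §13.2 ⟺ Grothendieck's period conjecture for Nori motives over `ℚ`). Verbatim the transcendence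
  stub of the birth skeleton of crux `OffGenusOneSectorKernel` (route GenusOneIterated): ONE shared
  transcendence layer for the "rest of the summit" cruxes.
* `stub_motivicReachMzvSector` (ACCESSIBILITY off the MZV sector, conjecture-grade; the genuinely
  route-specific piece): for every classical datum with kernel data and every Nori symbol data `Ψ`,
  a formal combination `y` whose Nori symbol vanishes, `Ψ y = 0` in `𝒫̃⁺` — a MOTIVIC relation among
  KZ representations — is congruent modulo the moves to a `ℤ`-combination of Kontsevich simplex
  representations of multiple zeta values (any weights): `∃ c' ∈ closure {of (mzvRep s)}, y − c' ∈
  KZ.relations`. "Every motivic period relation can be moved by rules 1)–3) until only iterated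
  integrals on simplices remain." By (Ψ1) (`ev ∘ Ψ = eval`) and `S_w ⊆ S` this stub is implied by
  the crux in every model of the interfaces, so it is never stronger than the crux; it is the crux
  with the transcendence theory AND the weight bookkeeping removed (HMS 2017 Rem. 13.1.8 read modulo
  the MZV sector).
* `stub_weightSeparation` (WEIGHT SEPARATION inside the calculus, conjecture-grade = Zagier's
  direct-sum conjecture + derivability on the MZV sector across weights): a vanishing INHOMOGENEOUS
  `ℤ`-combination of simplex representations `mzvRep s` (mixed weights) is KZ-equivalent to a
  vanishing homogeneous one of a single weight. Literally the crux restricted to the MZV span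
  (so again never stronger than the crux); its content is the weight grading of MZV relations
  (Zagier 1994 §9; Goncharov; Brown 2012: motivic MZVs are weight-graded) together with Conjecture 1
  on each weight component but one (routes CoactionDevissage `SectorAssembly`, Grothendieck,
  this route's `MzvScissorsSector`).

Composition (`offSectorReduction_of_stubs`, a real proof, ≈ 15 lines; the registered theorem
`OffSectorReduction_of : OffSectorReduction` feeds the three stubs in BY NAME): given `c` with
`eval c = 0`, on the datum of `stub_classicalSymbolInjective` (Ψ1) turns this into
`ev (Ψ c) = 0` and injectivity into `Ψ c = 0`; accessibility gives `c ≡ c' (mod relations)` with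
`c'` in the MZV span; soundness of the moves (`KZ.relations_le_ker_eval_holds`) gives
`eval c' = eval c = 0`; weight separation gives `w`, `c''` homogeneous with `eval c'' = 0` and
`c' ≡ c''`; and `c − c'' = (c − c') + (c' − c'') ∈ relations`.

BC3 probes (registrar folder `bc/probe_*.lean`, importing the route file + the two Literature
modules, NOT this file): for each stub, `stub → OffSectorReduction` and `stub → KontsevichZagierPeriods`
by `first | exact? | simpa | aesop` FAIL (T has no accessibility content; A needs a datum on which
`Ψ c = 0` follows from `eval c = 0` and says nothing about weights; W only speaks about the MZV span).
Disproof used: none on record (`ledger crux ls stmt-KontsevichZagierPeriods-4265`: no workfiles before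
this one; negatives index of the summit: one entry, KinematicPlaneConvex via `K = ∅`, unrelated — the
stubs are checked on degenerate data: `c = 0 ↦ c' = 0 ↦ c'' = 0`, `0 ∈` every closure).
Sorries live ONLY in the three `stub_*` theorems.
-/

noncomputable section

set_option linter.dupNamespace false

open Literature.NumberTheory.Transcendental
open Literature.AlgebraicGeometry.Motives (ClassicalPeriodDatum)
open Summit.KontsevichZagierPeriods.KontsevichZagierPeriods.Theses.ScissorsAvatars (OffSectorReduction)

namespace Summit.KontsevichZagierPeriods.KontsevichZagierPeriods.Cruxes.OffSectorReduction.Birth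

/-! ### Registered stubs -/

/-- **STUB T — `classicalSymbolInjective` (transcendence; construction + conjecture, GPC-strength).**
There is a classical period datum over `ℚ` with kernel data (the de Rham–Betti cohomology of pairs,
comparison pairing, connecting morphisms, relative exactness on normal-crossings pairs — HMS 2017
Ch. 3, §11; draft I §3) carrying Nori symbol data `Ψ` for the Kontsevich–Zagier calculus (every
representation has a symbol `(X, D, ω, γ)` with the right period and dimension, and every instance of
the four moves is a formal-period relation: HMS draft III Lemma 11.2.3, Thm. 11.2.4, Rem. 12.1.7) on
which the evaluation `ev : 𝒫̃⁺ → ℂ` of effective formal periods is INJECTIVE (Kontsevich's formal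
period conjecture for the classical datum, HMS 2017 Def. 13.1.1 / §13.2; equivalent to
Grothendieck's period conjecture for Nori motives over `ℚ`). Shared verbatim with the birth skeleton
of crux `OffGenusOneSectorKernel` (route GenusOneIterated). Why it might fail: only if periods of
`ℚ`-varieties satisfy a non-motivic algebraic relation (no candidate is known), or — for the
construction half — if some KZ move is not a formal-period relation (HMS Rem. 12.1.7, believed).
[Kontsevich1999 §4; KontsevichZagier2001 §4.1; HuberMullerStach2017 §13; Ayoub2014; Andre2004 Ch. 23] -/
theorem stub_classicalSymbolInjective :
    ∃ 𝒞 : ClassicalPeriodDatum ℚ, 𝒞.KernelData ∧ Nonempty (𝒞.NoriSymbolData (Rat.castHom ℂ)) ∧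
      FormalPeriodEvalInjective 𝒞.R 𝒞.B (Rat.castHom ℂ) := by
  sorry

/-- **STUB A — `motivicReachMzvSector` (accessibility off the MZV sector; conjecture-grade).** For
every classical period datum over `ℚ` with kernel data and every Nori symbol data `Ψ` on it: a formal
`ℤ`-combination `y` of integral representations whose Nori symbol vanishes in the effective formal
periods, `Ψ y = 0` (a MOTIVIC relation), is congruent modulo `KZ.relations` to a `ℤ`-combination of
Kontsevich simplex representations `mzvRep s` of multiple zeta values (admissible `s`, any weight).
Equivalently: the class of every motivic relation in `FormalRep ⧸ relations` lies in the image of the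
MZV sector. Implied by the crux in every model ((Ψ1): `Ψ y = 0 ⇒ eval y = 0`, then `S_w ⊆ S`); with
STUB T and Conjecture 1 on the inhomogeneous MZV sector it gives back the kernel conjecture. Why it
might fail: a motivic relation among non-mixed-Tate periods (elliptic, K3, Γ-values) whose only
derivations leave the MZV residue class non-trivially — i.e. Conjecture 1 failing off the sector
while holding on it; or junk models of the interfaces with `ker Ψ = ker eval` (then this stub is the
inhomogeneous kernel conjecture modulo the sector — still open, still weaker than the crux).
[KontsevichZagier2001 §1.2, §4.1; HuberMullerStach2017 Rem. 13.1.8; Brown2012; Ayoub2015 Rem. 1.2] -/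
theorem stub_motivicReachMzvSector :
    ∀ 𝒞 : ClassicalPeriodDatum ℚ, 𝒞.KernelData →
      ∀ (Ψ : 𝒞.NoriSymbolData (Rat.castHom ℂ)) (y : KZ.FormalRep), KZ.noriSymbol Ψ y = 0 →
        ∃ c' : KZ.FormalRep,
          c' ∈ AddSubgroup.closure {x : KZ.FormalRep | ∃ (s : List ℕ) (hs : MZV.IsAdmissible s),
            x = KZ.of (KZ.mzvRep s hs (KZ.mzvIntegrand_isSemialgebraicFunOn_holds s)
              (KZ.mzvIntegrand_integrableOn_holds s hs))} ∧
          y - c' ∈ KZ.relations := by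
  sorry

/-- **STUB W — `weightSeparation` (weight separation inside the calculus; conjecture-grade).** A
vanishing INHOMOGENEOUS `ℤ`-combination `c'` of Kontsevich simplex representations (mixed weights,
`eval c' = 0`) is KZ-equivalent to a vanishing HOMOGENEOUS combination `c''` of a single weight `w`:
`c'' ∈ closure {of (mzvRep s) | weight s = w}`, `eval c'' = 0`, `c' − c'' ∈ KZ.relations`. Literally
the crux restricted to the MZV span (never stronger than the crux). Content: the weight grading of
the `ℚ`-linear relations among MZVs (Zagier's direct-sum conjecture, 1994 §9; a theorem for MOTIVIC
MZVs, Brown 2012 / Deligne–Goncharov 2005, hence a consequence of STUB T for real ones) AND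
Conjecture 1 on every weight component but one (each `c'_v`, `v ≠ w`, must be a relation: routes
CoactionDevissage `SectorAssembly`, Grothendieck, and this route's `MzvScissorsSector` with NL allowed).
Why it might fail: a cross-weight `ℤ`-linear relation among real MZVs (would contradict the period
conjecture for `MT(ℤ)`), or a true homogeneous MZV relation with no derivation in the calculus.
[Zagier1994 §9; Brown2012; IharaKanekoZagier2006; KontsevichZagier2001 §1.2] -/
theorem stub_weightSeparation :
    ∀ c' : KZ.FormalRep,
      c' ∈ AddSubgroup.closure {x : KZ.FormalRep | ∃ (s : List ℕ) (hs : MZV.IsAdmissible s),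
        x = KZ.of (KZ.mzvRep s hs (KZ.mzvIntegrand_isSemialgebraicFunOn_holds s)
          (KZ.mzvIntegrand_integrableOn_holds s hs))} →
      KZ.eval c' = 0 →
      ∃ (w : ℕ) (c'' : KZ.FormalRep),
        c'' ∈ AddSubgroup.closure {x : KZ.FormalRep | ∃ (s : List ℕ) (hs : MZV.IsAdmissible s),
          MZV.weight s = w ∧ x = KZ.of (KZ.mzvRep s hs (KZ.mzvIntegrand_isSemialgebraicFunOn_holds s)
            (KZ.mzvIntegrand_integrableOn_holds s hs))} ∧
        KZ.eval c'' = 0 ∧ c' - c'' ∈ KZ.relations := by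
  sorry

/-! ### Composition (no `sorry` below this line) -/

/-- **(Ψ1) + injectivity of `ev`: numerical relations are motivic.** On a classical period datum
carrying Nori symbol data `Ψ` with `ev` injective on the effective formal periods, a formal
combination of integral representations with value `0` has Nori symbol `0`:
`eval y = 0 ⇒ ev (Ψ y) = 0 ⇒ Ψ y = 0` (Kontsevich–Zagier 2001 §4.1; Huber–Müller-Stach 2017 §13.1;
the first half of `KZ.kernel_subset_relations_of_isFaithful`). Sorry-free helper of the composition.
[folklore] -/
theorem noriSymbol_eq_zero_of_eval_eq_zero (𝒞 : ClassicalPeriodDatum ℚ)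
    (Ψ : 𝒞.NoriSymbolData (Rat.castHom ℂ))
    (hinj : FormalPeriodEvalInjective 𝒞.R 𝒞.B (Rat.castHom ℂ)) {y : KZ.FormalRep}
    (hy : KZ.eval y = 0) : KZ.noriSymbol Ψ y = 0 := by
  have h1 : Literature.AlgebraicGeometry.Motives.AlongHom.equiv (Rat.castHom ℂ)
      (formalPeriodEval 𝒞.R (Rat.castHom ℂ) (Ψ.symbol y)) = 0 := by
    rw [Ψ.eval_symbol y, hy]
    simp
  have h2 : formalPeriodEval 𝒞.R (Rat.castHom ℂ) (Ψ.symbol y) = 0 := by simpa using h1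
  rw [KZ.noriSymbol_apply, Submodule.mkQ_apply, Submodule.Quotient.mk_eq_zero]
  exact hinj _ h2

/-- **Soundness along a congruence**: if `y ≡ c' (mod KZ.relations)` and `eval y = 0` then
`eval c' = 0` (`KZ.relations_le_ker_eval_holds`). Sorry-free helper. [folklore] -/
theorem eval_eq_zero_of_sub_mem_relations {y c' : KZ.FormalRep} (hy : KZ.eval y = 0)
    (h : y - c' ∈ KZ.relations) : KZ.eval c' = 0 := by
  have h0 : KZ.eval (y - c') = 0 := KZ.relations_le_ker_eval_holds h
  rw [map_sub, hy, zero_sub, neg_eq_zero] at h0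
  exact h0

set_option linter.defProp false in
/-- **Composition, hypotheses form (pure logic + soundness of the moves + (Ψ1)).** The three stub
STATEMENTS imply the crux BY NAME: read `Ψ c = 0` off injectivity on the datum of the transcendence
stub, reach the MZV span by accessibility (`c ≡ c'`), transport `eval c = 0` to `eval c' = 0` by
soundness, separate weights (`c' ≡ c''`, `c''` homogeneous and vanishing), and add the two
congruences. Declared as a `def` so that `OffSectorReduction_of` below is the unique theorem of
this file concluding the crux (skeleton audit). [folklore] -/
def offSectorReduction_of_stubs :
    (∃ 𝒞 : ClassicalPeriodDatum ℚ, 𝒞.KernelData ∧ Nonempty (𝒞.NoriSymbolData (Rat.castHom ℂ)) ∧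
      FormalPeriodEvalInjective 𝒞.R 𝒞.B (Rat.castHom ℂ)) →
    (∀ 𝒞 : ClassicalPeriodDatum ℚ, 𝒞.KernelData →
      ∀ (Ψ : 𝒞.NoriSymbolData (Rat.castHom ℂ)) (y : KZ.FormalRep), KZ.noriSymbol Ψ y = 0 →
        ∃ c' : KZ.FormalRep,
          c' ∈ AddSubgroup.closure {x : KZ.FormalRep | ∃ (s : List ℕ) (hs : MZV.IsAdmissible s),
            x = KZ.of (KZ.mzvRep s hs (KZ.mzvIntegrand_isSemialgebraicFunOn_holds s)
              (KZ.mzvIntegrand_integrableOn_holds s hs))} ∧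
          y - c' ∈ KZ.relations) →
    (∀ c' : KZ.FormalRep,
      c' ∈ AddSubgroup.closure {x : KZ.FormalRep | ∃ (s : List ℕ) (hs : MZV.IsAdmissible s),
        x = KZ.of (KZ.mzvRep s hs (KZ.mzvIntegrand_isSemialgebraicFunOn_holds s)
          (KZ.mzvIntegrand_integrableOn_holds s hs))} →
      KZ.eval c' = 0 →
      ∃ (w : ℕ) (c'' : KZ.FormalRep),
        c'' ∈ AddSubgroup.closure {x : KZ.FormalRep | ∃ (s : List ℕ) (hs : MZV.IsAdmissible s),
          MZV.weight s = w ∧ x = KZ.of (KZ.mzvRep s hs (KZ.mzvIntegrand_isSemialgebraicFunOn_holds s)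
            (KZ.mzvIntegrand_integrableOn_holds s hs))} ∧
        KZ.eval c'' = 0 ∧ c' - c'' ∈ KZ.relations) →
    OffSectorReduction := by
  intro hT hA hW c hc
  -- the classical datum with its Nori symbol, `ev` injective on its effective formal periods
  obtain ⟨𝒞, h𝒞, ⟨Ψ⟩, hinj⟩ := hT
  -- (Ψ1) + injectivity of `ev`: the numerical relation `eval c = 0` is motivic, `Ψ c = 0`
  have hΨ : KZ.noriSymbol Ψ c = 0 := noriSymbol_eq_zero_of_eval_eq_zero 𝒞 Ψ hinj hc
  -- accessibility off the sector: `c ≡ c'` with `c'` in the (inhomogeneous) MZV span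
  obtain ⟨c', hc'S, hcc'⟩ := hA 𝒞 h𝒞 Ψ c hΨ
  -- soundness of the moves: `eval c' = eval c = 0`
  have hc'0 : KZ.eval c' = 0 := eval_eq_zero_of_sub_mem_relations hc hcc'
  -- weight separation inside the MZV span
  obtain ⟨w, c'', hc''S, hc''0, hc'c''⟩ := hW c' hc'S hc'0
  refine ⟨w, c'', hc''S, hc''0, ?_⟩
  -- add the two congruences
  have hsum : c - c'' = (c - c') + (c' - c'') := by abel
  rw [hsum]
  exact add_mem hcc' hc'c''

/-- **Skeleton theorem (registered form).** The crux `OffSectorReduction` BY NAME from the three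
declared stubs, via the sorry-free composition `offSectorReduction_of_stubs`; `sorry` occurs only
inside `stub_classicalSymbolInjective`, `stub_motivicReachMzvSector`, `stub_weightSeparation`. -/
theorem OffSectorReduction_of : OffSectorReduction :=
  offSectorReduction_of_stubs stub_classicalSymbolInjective stub_motivicReachMzvSector
    stub_weightSeparation

end Summit.KontsevichZagierPeriods.KontsevichZagierPeriods.Cruxes.OffSectorReduction.Birth

end
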